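import Mathlib
import Summits.Ventures.PercRepro2.Harris
import Summits.Ventures.PercRepro2.BasePrime
import Summits.Ventures.PercRepro2.LocRows
import Summits.Ventures.PercRepro2.SwRow
import Summits.Ventures.PercRepro2.SwOutCube
import Summits.Ventures.PercRepro2.SwOutMixedCubeFarDefs
import Summits.Ventures.PercRepro2.SwOutMixedCubeFar

/-!
# The twisted cube lemma with far arms under the WEAK hypothesis (blind cell PercRepro2, night-4 g17,
2026-08-27; proofs/NIGHT4-G17.md §1)

`mixedCubeFar_card_le` (SwOutMixedCubeFar) assumes the conditioning set `Q` is a lower set of the whole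
block `Bool × Config (Fin 2 ⊕ κ)`.  Its proof never uses the order ACROSS the two seal layers: the
bottom layer is handled by the cube principle on its own, and the top layer minus the middle by the two
corner fibres.  This file isolates exactly what is used — the hypothesis `WeakLower Q`:

* the bottom layer `{ω | (false, ω) ∈ Q}` is a lower set of the atom cube;
* each top-layer corner fibre `fibreL Q c = {f | (true, setXA c f) ∈ Q}` is a lower set of the far cube;
* the fibre of the upper corner `X = A = true` lies in the fibre of the lower corner `X = A = false`

— and proves **`mixedCubeFar_card_le'`** under it (the same proof).  The point: on the real one-mixed-arm
blocks the twisted-order lowerness across the layers FAILS (the n = 10 witness of NIGHT4-G17.md §0: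
unsealing the dropped piece can let the blue cluster of `l` walk through it and the h-piece's blue
outside edges to `o`), while `WeakLower` held on every block of the census (mining/night-4/g17).
`WeakLower.of_isLowerSet` recovers the old hypothesis.
-/

namespace Summit.Ventures.PercRepro2

namespace MixedCube

open scoped Classical

variable {κ : Type*} [Fintype κ] [DecidableEq κ]

section Weak

variable (Q : Set (PtF κ))

/-- **The weak hypothesis (W)** on the conditioning set of the block: the bottom layer is a lower set
of the atoms, the two top-layer corner fibres are lower sets of the far cube, and the upper corner's
fibre lies in the lower corner's. -/
structure WeakLower : Prop where
  bottom : IsLowerSet {ω : Config (Atom κ) | (false, ω) ∈ Q}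
  fibre : ∀ c, IsLowerSet (fibreL Q c)
  corner : fibreL Q true ⊆ fibreL Q false

variable {Q}

omit [Fintype κ] [DecidableEq κ] in
/-- A lower set of the block satisfies (W). -/
theorem WeakLower.of_isLowerSet (hQ : IsLowerSet Q) : WeakLower Q where
  bottom := by
    intro ω ω' hle hω
    exact hQ (Prod.mk_le_mk.2 ⟨le_refl _, hle⟩) hω
  fibre := fun c => fibreL_isLowerSet hQ c
  corner := fibreL_true_subset hQ

variable (𝓔 : Set (Set (Atom κ)))

variable (hW : WeakLower Q) (h𝓔 : IsUpperSet 𝓔)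
include hW h𝓔

/-- **The cube principle on a far fibre**, under (W). -/
lemma card_fibre_le' (c : Bool) :
    (Finset.univ.filter (· ∈ fibreL Q c ∩ fibreU 𝓔 c)).card ≤
      (Finset.univ.filter (· ∈ fibreL Q c ∩ flipAll ⁻¹' fibreU 𝓔 c)).card :=
  LocRows.card_inter_le_of_cube (hW.fibre c) (fibreU_isUpperSet h𝓔 c)
    (flipAll_preimage_fibreU_isLowerSet h𝓔 c) (flipAll_preimage_preimage _)

/-- **The top layer minus the middle satisfies the rigid inequality**, under (W). -/
theorem card_top_le' :
    (Finset.univ.filter fun ω : Config (Atom κ) =>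
        ω (Sum.inl 0) = ω (Sum.inl 1) ∧ ((true, ω) ∈ Q ∧ redAtoms ω ∈ 𝓔)).card ≤
      (Finset.univ.filter fun ω : Config (Atom κ) =>
        ω (Sum.inl 0) = ω (Sum.inl 1) ∧ ((true, ω) ∈ Q ∧ redAtoms (flipAll ω) ∈ 𝓔)).card := by
  rw [card_filter_top (S := fun ω => (true, ω) ∈ Q ∧ redAtoms ω ∈ 𝓔),
    card_filter_top (S := fun ω => (true, ω) ∈ Q ∧ redAtoms (flipAll ω) ∈ 𝓔),
    card_filter_fibre false (S := fun ω => (true, ω) ∈ Q ∧ redAtoms ω ∈ 𝓔),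
    card_filter_fibre true (S := fun ω => (true, ω) ∈ Q ∧ redAtoms ω ∈ 𝓔),
    card_filter_fibre false (S := fun ω => (true, ω) ∈ Q ∧ redAtoms (flipAll ω) ∈ 𝓔),
    card_filter_fibre true (S := fun ω => (true, ω) ∈ Q ∧ redAtoms (flipAll ω) ∈ 𝓔)]
  have e1 : (Finset.univ.filter fun f : Config κ =>
      (true, setXA false f) ∈ Q ∧ redAtoms (setXA false f) ∈ 𝓔) =
      Finset.univ.filter (· ∈ fibreL Q false ∩ fibreU 𝓔 false) := by
    apply Finset.filter_congr; intro f _; rfl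
  have e2 : (Finset.univ.filter fun f : Config κ =>
      (true, setXA true f) ∈ Q ∧ redAtoms (setXA true f) ∈ 𝓔) =
      Finset.univ.filter (· ∈ fibreL Q true ∩ fibreU 𝓔 true) := by
    apply Finset.filter_congr; intro f _; rfl
  have e3 : (Finset.univ.filter fun f : Config κ =>
      (true, setXA false f) ∈ Q ∧ redAtoms (flipAll (setXA false f)) ∈ 𝓔) =
      Finset.univ.filter (· ∈ fibreL Q false ∩ flipAll ⁻¹' fibreU 𝓔 true) := by
    apply Finset.filter_congr; intro f _
    simp only [flipAll_setXA, Bool.not_false, fibreL, fibreU, Set.mem_inter_iff,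
      Set.mem_preimage, Set.mem_setOf_eq]
  have e4 : (Finset.univ.filter fun f : Config κ =>
      (true, setXA true f) ∈ Q ∧ redAtoms (flipAll (setXA true f)) ∈ 𝓔) =
      Finset.univ.filter (· ∈ fibreL Q true ∩ flipAll ⁻¹' fibreU 𝓔 false) := by
    apply Finset.filter_congr; intro f _
    simp only [flipAll_setXA, Bool.not_true, fibreL, fibreU, Set.mem_inter_iff,
      Set.mem_preimage, Set.mem_setOf_eq]
  rw [e1, e2, e3, e4]
  have c0 := card_fibre_le' 𝓔 hW h𝓔 false
  have c1 := card_fibre_le' 𝓔 hW h𝓔 true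
  have ex := card_exchange hW.corner
    (Set.preimage_mono (fibreU_false_subset h𝓔) : flipAll ⁻¹' fibreU 𝓔 false ⊆
      flipAll ⁻¹' fibreU 𝓔 true)
  omega

/-- **The bottom layer satisfies the rigid inequality**, under (W) (the cube principle). -/
theorem card_bottom_le' :
    (Finset.univ.filter fun ω : Config (Atom κ) => (false, ω) ∈ Q ∧ redAtoms ω ∈ 𝓔).card ≤
      (Finset.univ.filter fun ω : Config (Atom κ) =>
        (false, ω) ∈ Q ∧ redAtoms (flipAll ω) ∈ 𝓔).card := by
  have hA : IsUpperSet {ω : Config (Atom κ) | redAtoms ω ∈ 𝓔} := by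
    intro ω ω' hle hω
    exact h𝓔 (redAtoms_mono hle) hω
  have hB : IsLowerSet {ω : Config (Atom κ) | redAtoms (flipAll ω) ∈ 𝓔} := by
    intro ω ω' hle hω
    exact h𝓔 (redAtoms_mono (flipAll_le_flipAll' hle)) hω
  have hAB : flipAll ⁻¹' {ω : Config (Atom κ) | redAtoms (flipAll ω) ∈ 𝓔} =
      {ω : Config (Atom κ) | redAtoms ω ∈ 𝓔} := by
    ext ω
    simp only [Set.mem_preimage, Set.mem_setOf_eq, flipAll_involutive ω]
  have key := LocRows.card_inter_le_of_cube hW.bottom hA hB hAB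
  convert key using 2
  · apply Finset.filter_congr
    intro ω _
    simp only [Set.mem_inter_iff, Set.mem_setOf_eq]
  · apply Finset.filter_congr
    intro ω _
    simp only [Set.mem_inter_iff, Set.mem_setOf_eq]

/-- **THE TWISTED CUBE LEMMA WITH FAR ARMS UNDER (W)**: for every conditioning set `Q` satisfying
`WeakLower` and every up-set `𝓔` of atom sets, the block minus the removed points (the one-sided point
and its mirror with every far colouring) satisfies the rigid counting inequality. -/
theorem mixedCubeFar_card_le' :
    (Finset.univ.filter (redOK Q 𝓔)).card ≤ (Finset.univ.filter (blueOK Q 𝓔)).card := by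
  rw [card_filter_prod_bool (redOK Q 𝓔), card_filter_prod_bool (blueOK Q 𝓔)]
  have hb : ∀ ω : Config (Atom κ), ¬ MidTop (false, ω) := by
    intro ω h
    exact Bool.false_ne_true h.1
  have ht : ∀ ω : Config (Atom κ), ¬ MidTop (true, ω) ↔ ω (Sum.inl 0) = ω (Sum.inl 1) := by
    intro ω
    simp only [MidTop, true_and, not_not]
  have f1 : (Finset.univ.filter fun ω : Config (Atom κ) => redOK Q 𝓔 (false, ω)) =
      Finset.univ.filter fun ω : Config (Atom κ) => (false, ω) ∈ Q ∧ redAtoms ω ∈ 𝓔 := by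
    apply Finset.filter_congr; intro ω _
    simp only [redOK, hb ω, not_false_eq_true, true_and]
  have f2 : (Finset.univ.filter fun ω : Config (Atom κ) => blueOK Q 𝓔 (false, ω)) =
      Finset.univ.filter fun ω : Config (Atom κ) =>
        (false, ω) ∈ Q ∧ redAtoms (flipAll ω) ∈ 𝓔 := by
    apply Finset.filter_congr; intro ω _
    simp only [blueOK, hb ω, not_false_eq_true, true_and]
  have f3 : (Finset.univ.filter fun ω : Config (Atom κ) => redOK Q 𝓔 (true, ω)) =
      Finset.univ.filter fun ω : Config (Atom κ) =>
        ω (Sum.inl 0) = ω (Sum.inl 1) ∧ ((true, ω) ∈ Q ∧ redAtoms ω ∈ 𝓔) := by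
    apply Finset.filter_congr; intro ω _
    simp only [redOK, ht ω]
    constructor
    · rintro ⟨hQ', h01, hE⟩; exact ⟨h01, hQ', hE⟩
    · rintro ⟨h01, hQ', hE⟩; exact ⟨hQ', h01, hE⟩
  have f4 : (Finset.univ.filter fun ω : Config (Atom κ) => blueOK Q 𝓔 (true, ω)) =
      Finset.univ.filter fun ω : Config (Atom κ) =>
        ω (Sum.inl 0) = ω (Sum.inl 1) ∧ ((true, ω) ∈ Q ∧ redAtoms (flipAll ω) ∈ 𝓔) := by
    apply Finset.filter_congr; intro ω _
    simp only [blueOK, ht ω]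
    constructor
    · rintro ⟨hQ', h01, hE⟩; exact ⟨h01, hQ', hE⟩
    · rintro ⟨h01, hQ', hE⟩; exact ⟨hQ', h01, hE⟩
  rw [f1, f2, f3, f4]
  have hbot := card_bottom_le' 𝓔 hW h𝓔
  have htop := card_top_le' 𝓔 hW h𝓔
  omega

end Weak

/-- The lower-set version is the special case `WeakLower.of_isLowerSet`. -/
theorem mixedCubeFar_card_le_of_isLowerSet {Q : Set (PtF κ)} {𝓔 : Set (Set (Atom κ))}
    (hQ : IsLowerSet Q) (h𝓔 : IsUpperSet 𝓔) :
    (Finset.univ.filter (redOK Q 𝓔)).card ≤ (Finset.univ.filter (blueOK Q 𝓔)).card :=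
  mixedCubeFar_card_le' 𝓔 (WeakLower.of_isLowerSet hQ) h𝓔

end MixedCube

end Summit.Ventures.PercRepro2
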